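import Summits.Ventures.QEC.Census.CertCoverBatch
import Summits.Ventures.QEC.Census.BB.A1s_n192_k4_0fa3ae82.Cert
import Summits.Ventures.QEC.Census.BB.A1s_n192_k4_0fa3ae82.CoreDefs
import Summits.Ventures.QEC.Census.BB.A1s_n192_k4_0fa3ae82.Q96LowBridge
import HarnessLib

set_option Elab.async false
set_option maxRecDepth 200000

/-!
# `[[192,4,18]]` one-level cover certificate — ASSEMBLY side: the CORE facts not already in qec-type-10's `Cert.lean` (p537859)
(qec-search-9 g5, lead block 170 (0)(c) / arbitration 14:18:02Z). `Cert.lean` (type-10, imported) decides the structure of `cert`, `core192`/`core96`,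
`comm192`/`comm96m`, the rank checks, `swap_ok`, `covs_ok`, `rows_ok`, `parity_ok`, `hbd192`, `hLab192`, `hDq1`, `D1_ker`. Added here: the
push-forward table `push1_ok` (over search-9's basis `eGb`, data `coef1` of `CoreDefs`) and `hspan1` (T1's `hspan`, `CertCoverProducers.span1_of_core`),
`lxd_len`, and ★ `hzero : NoBadOver cov hx hz 16 0` from search-9's `q96_low8'` (the quotient's flat `Z`-distance `> 8`; `16 < 2·9`;
`noBadOver_zero_of_quotient`). Theorems only; KERNEL.
-/

namespace Summit.Ventures.QEC.Census.A1s_n192_k4_0fa3ae82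

open Matrix Summit.Ventures.QEC.Census Literature.InformationTheory.QuantumCodes

/-- PUSH-FORWARD TABLE: `cov.push` of every generator of `ker H^X₁₉₂` (`hz ++ lz`) is the stated combination of `eGb`. -/
theorem push1_ok : push1GensOK cov (hz ++ lz) eGb coef1 = true := by decide +kernel

/-- **`hspan1`**: the push-forward of every `H^X₁₉₂`-kernel word lies in `rowspace eGb` (= `C_M`). -/
theorem hspan1 : ∀ v : ℕ, v < 2 ^ cov.n → synZero cov.n hx v = true → ofBits cov.nq (cov.push v) ∈ rowSpace (rowMatrix cov.nq eGb) :=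
  span1_of_core comm192 core192 hbd192 push1_ok

/-- `lxd` lists 4 dual words. -/
theorem lxd_len : lxd.length = 4 := by decide

/-- `D1 = hz1 ++ lz1 ⊆ ker H^X₉₆` in the `D1` spelling (type-10's `D1_ker`). -/
theorem D1_ker' : (D1.all fun x => synZero 96 hx1 x) = true := D1_ker

/-- `ker H^X₉₆ ⊆ span D1` in the `cov.nq`/`D1` spelling (type-10's `hDq1`). -/
theorem hDq1' : ∀ z : Fin cov.nq → ZMod 2, rowMatrix cov.nq hx1 *ᵥ z = 0 →
    z ∈ Submodule.span (ZMod 2) (Set.range fun i : Fin D1.length => ofBits cov.nq D1[i]) := hDq1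

/-- ★ **The `u = 0` case**: no bad word of weight `≤ 16` pushes forward to `0` (the quotient's flat `Z`-distance is `> 8`, search-9 `q96_low8'`;
`16 < 2·(8+1)`; `CertCoverProducers.noBadOver_zero_of_quotient`). -/
theorem hzero : NoBadOver cov hx hz 16 0 :=
  noBadOver_zero_of_quotient covs_ok.1 covs_ok.2 rows_ok.1 rows_ok.2.2 (by norm_num) q96_low8'

end Summit.Ventures.QEC.Census.A1s_n192_k4_0fa3ae82
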